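import Literature.AnabelianGeometry.SemiGraphs.TemperedReconstructionReductions
import Literature.AnabelianGeometry.SemiGraphs.TemperedFunctorialityInducesLiteral
import Literature.AnabelianGeometry.SemiGraphs.TemperedVerticialNamedFactsProofs
import Literature.AnabelianGeometry.SemiGraphs.TemperedCompactInVerticialFinite
import Literature.AnabelianGeometry.SemiGraphs.TemperedPiChartExists
import Literature.AnabelianGeometry.SemiGraphs.ThetaRayMaximalCompactEscapingFreeProP
import Literature.AnabelianGeometry.SemiGraphs.WitnessIwahoriBundle
import Literature.AnabelianGeometry.SemiGraphs.WitnessIwahoriCoherent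
import Literature.AnabelianGeometry.SemiGraphs.PadicIntProPCompletion
import HarnessLib

/-!
# `¬ InducedIsQuasiGeometric`: step (R0) of the typed proof of [SemiAnbd] Cor 3.9 is false as an
# ∀-countable statement — the alternating fold of `𝒢_θ(p, n)` onto the Iwahori loop

Mochizuki, *Semi-graphs of anabelioids*, Publ. RIMS **42** (2006) [MochizukiSemiAnbd2006], §3, Cor. 3.9 and
its proof, manuscript p. 42 [cite: MochizukiSemiAnbd2006, Cor 3.9 p.42]: "any locally open morphism of
semi-graphs of anabelioids `G → H` determines a morphism of temperoids `B^temp(G) → B^temp(H)` [cf. Proposition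
3.6, (iv)] whose quasi-geometricity follows by 'substituting' the equivalences of Theorem 3.7, (iv), into
Definition 3.8".  The cell's typed residual fact (R0) `ProfiniteSemiGraph.InducedIsQuasiGeometric`
(`TemperedReconstructionReductions.lean`) asserts this for ALL pairs of Cor-3.9 graphs of anabelioids
(countable, possibly infinite), all charts, all locally open `F` and all `φ` compatible with `F` on the
verticial and edge homomorphisms.

PROOF-ONLY file (abc-iut cell, seat abc-iut-w6-d099 gen 4, L-F pack A row F-1717 / table-v5 cell C5; 0
definitions, no named fact).  THE WITNESS:

* source `𝒢 := 𝒢_θ(p, n)` (`thetaRayFreeProP`, abc-iut-L3-d1's ray of free pro-`p` groups of rank 2 glued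
  along `ℤ_p` by `a` and `a·b^{p^{n_k}}`), `p` odd, `n_k ≥ 1`; by abc-iut-f-175's
  `thetaRayFreeProP_exists_maximalCompact_escaping` its tempered fundamental group (canonical chart) has an
  ABELIAN maximal compact subgroup `C = ζ(ℤ_p)` (lying in no verticial subgroup) — consumed BY NAME;
* target `ℋ := IwahoriWitness.loopGraph p` (one vertex `P = ℤ_p ⋊ (1+pℤ_p)`, one estranged loop `U = 1+pℤ_p`,
  branches the torus `T₀` and the twisted complement `T₁`; `Cor39Hypotheses` kernel-checked, abc-iut-w5-d236);
* `F : 𝒢 → ℋ` the ALTERNATING FOLD (`exists_isLocallyOpen_hom_thetaRayFreeProP_loopGraph`): every vertex to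
  the vertex, every edge to the loop, the branch of `e_k` at `v_j` (`j ∈ {k, k+1}`) to the loop branch of
  coefficient `j mod 2` (so the two branches of `e_k` go to distinct loop branches); vertex homomorphisms
  `f_j : F̂₂⁽ᵖ⁾ → P`, `a ↦ (j mod 2, 1)`, `b ↦ (1, 0)` (universal property of the pro-`p` completion), edge
  homomorphisms `ℤ_p → U`, `1 ↦ 1+p`; the 2-cells hold with conjugators `1` (at `β_k⁺`) and
  `(−(1+p)p^{n_k−1}, 0)` (at `β_k⁻`: `f_k(a·b^{p^{n_k}}) = (k mod 2 + (1+p)p^{n_k}, 1)` is a `P`-conjugate of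
  `b_{k mod 2}(1+p)`); `F` is locally open (all these homomorphisms are onto, `p` odd);
* `φ :=` the homomorphism INDUCED by `F` (Prop. 3.6 (iv), abc-iut-L3-t10's `inducedHomOfMorphism_induces`),
  which is compatible with `F` on verticial and edge homomorphisms (step (R1)).

Then `φ` is not quasi-geometric — indeed NO continuous `φ : π₁^temp(𝒢_θ) → π₁^temp(ℋ)` is: Def. 3.8 asks the
image of the maximal compact `C` to be an open subgroup of a maximal compact subgroup `K₂` of `π₁^temp(ℋ)`; by
Thm. 3.7 (iv) at the FINITE graph `ℋ` (`maximalCompactIffVerticialAt_of_finiteGraph`) and Thm. 3.7 (i)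
(`verticialInjective_holds`) `K₂ ≅ P`, and `P` has no abelian open subgroup (`(p^m,0)`, `(0,p^m)` do not
commute).  Hence **`not_inducedIsQuasiGeometric : ¬ InducedIsQuasiGeometric.{0}`**.

HONEST FRAMING / release-note class (abc-iut-L3-lead β51): «∀-closure refuted-as-typed (misstated-as-∀),
instances of record stand» — the repaired statements are the tree's PROVED forms
`inducedIsQuasiGeometricAt_of_finiteGraph`, `inducedIsQuasiGeometricAt_of_compactInVerticialAt` (p452440) and
`InducedIsQuasiGeometric_of` (conditional on Thm 3.7 (iv) as typed).  The refutation lives at an INFINITE graph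
of anabelioids where "maximal compact = verticial" fails ([IUTchI] Rmk 2.5.3's countable setting); [SemiAnbd]
Cor 3.9 as printed and as used (finite dual semi-graphs) is not claimed false; no side is taken on
[IUTchIII] Cor. 3.12.
-/

noncomputable section

open scoped Topology
open CategoryTheory Multiplicative Filter

namespace Literature.AnabelianGeometry.SemiGraphs

open Literature.AnabelianGeometry.Anabelioids (IsSigmaInteger)
open Literature.AnabelianGeometry.SemiGraphs.SemiGraphOfAnabelioids.IsProSigmaCompletion
  (exists_continuous_extend_profinite)

/-! ### 1. `U = 1 + pℤ_p` and `P = ℤ_p ⋊ U` are pro-`p`; continuous homomorphisms into them -/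

namespace IwU

variable {p : ℕ} [hp : Fact p.Prime]

/-- Open subgroups of `U = 1 + pℤ_p` have `p`-power index (they contain a level box `ker(U → U_m)`, of
index `p^m`). [cite: MochizukiSemiAnbd2006, Def 2.3(i) p.24] -/
theorem isSigmaInteger_index (V : Subgroup (IwU p)) (hVo : IsOpen (V : Set (IwU p))) :
    IsSigmaInteger ({p} : Set ℕ) V.index := by
  obtain ⟨m, hm⟩ := exists_level_subset_of_mem_nhds (hVo.mem_nhds V.one_mem)
  have hle : (toMod (p := p) m).ker ≤ V := fun g hg => hm g hg
  have hker : (toMod (p := p) m).ker.index = p ^ m := by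
    rw [Subgroup.index_ker, MonoidHom.range_eq_top.mpr (toMod_surjective m), Subgroup.card_top,
      Nat.card_congr (IwUMod.equivZMod (p := p) (n := m)), Nat.card_zmod]
  have hdvd : V.index ∣ p ^ m := hker ▸ Subgroup.index_dvd_of_le hle
  exact ⟨Nat.pos_of_dvd_of_pos hdvd (pow_pos hp.out.pos m),
    fun q hq hqd => (Nat.prime_dvd_prime_iff_eq hq hp.out).mp (hq.dvd_of_dvd_pow (hqd.trans hdvd))⟩

/-- `ℤ_p`-powers in `U`: for every `u ∈ U` there is a continuous `ℤ_p → U` with `1 ↦ u` (universal property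
of the pro-`p` completion `ℤ → ℤ_p` towards the pro-`p` group `U`). [cite: RibesZalesskii2010, §4.1] -/
theorem exists_zpow (u : IwU p) : ∃ g : Multiplicative ℤ_[p] →ₜ* IwU p, g (ofAdd 1) = u := by
  obtain ⟨F, hF, hFι⟩ := exists_continuous_extend_profinite (PadicInt.isProSigmaCompletion_intCast (p := p))
    (fun V _ hVo => isSigmaInteger_index V hVo) (zpowersHom (IwU p) u)
  refine ⟨⟨F, hF⟩, ?_⟩
  change F (ofAdd 1) = u
  have h := hFι (ofAdd 1)
  rw [zpowersHom_apply, toAdd_ofAdd, zpow_one] at h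
  simpa using h

/-- For `p` odd, the subgroup generated by `1 + p` (coordinate `s = 1`) contains a level-`m` uniformizer
`1 + p^{m+1}c`, `c ∈ ℤ_pˣ`, for every `m` (`p`-th powers climb one level).
[cite: IrelandRosen1990, Ch. 4 §1 Thm. 2] -/
theorem exists_mem_closure_one_s_eq (hp2 : p ≠ 2) (m : ℕ) :
    ∃ z ∈ Subgroup.closure ({⟨1⟩} : Set (IwU p)), ∃ c : ℤ_[p], IsUnit c ∧ z.s = (p : ℤ_[p]) ^ m * c := by
  induction m with
  | zero => exact ⟨⟨1⟩, Subgroup.subset_closure (Set.mem_singleton _), 1, isUnit_one, by simp⟩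
  | succ m ih =>
    obtain ⟨z, hz, c, hc, hzs⟩ := ih
    obtain ⟨c', hc', h'⟩ := exists_pow_prime_s_eq m z c hc hzs (Or.inl hp2)
    exact ⟨z ^ p, Subgroup.pow_mem _ hz p, c', hc', h'⟩

/-- For `p` odd, every `x ∈ U` is congruent modulo the level-`m` box to a power of `1 + p`.
[cite: IrelandRosen1990, Ch. 4 §1 Thm. 2] -/
theorem exists_mem_closure_one_toMod_eq_one (hp2 : p ≠ 2) (m : ℕ) (x : IwU p) :
    ∃ h ∈ Subgroup.closure ({⟨1⟩} : Set (IwU p)), toMod m (x⁻¹ * h) = 1 := by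
  induction m with
  | zero =>
    exact ⟨1, Subgroup.one_mem _, by rw [toMod_eq_one_iff_dvd, pow_zero]; exact one_dvd _⟩
  | succ m ih =>
    obtain ⟨h, hh, hy⟩ := ih
    obtain ⟨z, hz, c, hc, hzs⟩ := exists_mem_closure_one_s_eq (p := p) hp2 m
    obtain ⟨j, hj⟩ := exists_mul_pow_toMod_succ_eq_one m (x⁻¹ * h) z hy c hc hzs
    exact ⟨h * z ^ j, Subgroup.mul_mem _ hh (Subgroup.pow_mem _ hz j), by rw [← mul_assoc]; exact hj⟩

/-- **For `p` odd, `U = 1 + pℤ_p` is topologically generated by `1 + p`.**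
[cite: IrelandRosen1990, Ch. 4 §1 Thm. 2] -/
theorem topologicalClosure_closure_one (hp2 : p ≠ 2) :
    (Subgroup.closure ({⟨1⟩} : Set (IwU p))).topologicalClosure = ⊤ := by
  refine SetLike.coe_injective ?_
  rw [Subgroup.topologicalClosure_coe, Subgroup.coe_top]
  refine Set.eq_univ_of_forall fun x => ?_
  rw [mem_closure_iff_nhds]
  intro W hW
  have hV : (fun y => x * y) ⁻¹' W ∈ 𝓝 (1 : IwU p) := by
    refine (continuous_const_mul x).continuousAt.preimage_mem_nhds ?_
    simpa using hW
  obtain ⟨n, hn⟩ := exists_level_subset_of_mem_nhds hV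
  obtain ⟨h, hh, hy⟩ := exists_mem_closure_one_toMod_eq_one hp2 n x
  exact ⟨h, by simpa using hn _ hy, hh⟩

/-- For `p` odd, a CLOSED subgroup of `U` containing `1 + p` is everything. [cite: IrelandRosen1990, Ch. 4 §1 Thm. 2] -/
theorem eq_top_of_isClosed_of_one_mem (hp2 : p ≠ 2) (H : Subgroup (IwU p)) (hH : IsClosed (H : Set (IwU p)))
    (h1 : (⟨1⟩ : IwU p) ∈ H) : H = ⊤ := by
  rw [eq_top_iff, ← topologicalClosure_closure_one hp2]
  exact Subgroup.topologicalClosure_minimal _ ((Subgroup.closure_le _).2 (Set.singleton_subset_iff.2 h1)) hH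

end IwU

namespace Iw

variable {p : ℕ} [hp : Fact p.Prime]

/-- Open subgroups of `P = ℤ_p ⋊ (1 + pℤ_p)` have `p`-power index (they contain a level box `ker(P → P_m)`,
of index `p^{2m}`). [cite: MochizukiSemiAnbd2006, Def 2.3(i) p.24] -/
theorem isSigmaInteger_index (V : Subgroup (Iw p)) (hVo : IsOpen (V : Set (Iw p))) :
    IsSigmaInteger ({p} : Set ℕ) V.index := by
  obtain ⟨m, hm⟩ := exists_level_subset_of_mem_nhds (hVo.mem_nhds V.one_mem)
  have hle : (toMod (p := p) m).ker ≤ V := fun g hg => hm g hg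
  have hker : (toMod (p := p) m).ker.index = p ^ (m + m) := by
    rw [Subgroup.index_ker, MonoidHom.range_eq_top.mpr (toMod_surjective m), Subgroup.card_top,
      Nat.card_congr (IwMod.equivProd (p := p) (n := m)), Nat.card_prod, Nat.card_zmod, pow_add]
  have hdvd : V.index ∣ p ^ (m + m) := hker ▸ Subgroup.index_dvd_of_le hle
  exact ⟨Nat.pos_of_dvd_of_pos hdvd (pow_pos hp.out.pos _),
    fun q hq hqd => (Nat.prime_dvd_prime_iff_eq hq hp.out).mp (hq.dvd_of_dvd_pow (hqd.trans hdvd))⟩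

open FreeProPRankTwo in
/-- Continuous homomorphisms `F̂₂⁽ᵖ⁾ → P` with prescribed values on the two topological generators
(universal property of the pro-`p` completion `F₂ → F̂₂⁽ᵖ⁾` towards the pro-`p` group `P`).
[cite: RibesZalesskii2010, §3.3] -/
theorem exists_lift (x y : Iw p) :
    ∃ f : Grp p →ₜ* Iw p, f (FreeProPRankTwo.a p) = x ∧ f (FreeProPRankTwo.b p) = y := by
  obtain ⟨F, hF, hFι⟩ := exists_continuous_extend_profinite (isProSigmaCompletion_ι p)
    (fun V _ hVo => isSigmaInteger_index V hVo) (FreeGroup.lift ![x, y])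
  refine ⟨⟨F, hF⟩, ?_, ?_⟩
  · change F (ι p (FreeGroup.of 0)) = x
    rw [hFι, FreeGroup.lift_apply_of]; rfl
  · change F (ι p (FreeGroup.of 1)) = y
    rw [hFι, FreeGroup.lift_apply_of]; rfl

/-- **An open subgroup of `P` is not commutative**: it contains `(p^m, 0)` and `(0, p^m)` for some `m`,
which do not commute. [cite: MochizukiSemiAnbd2006, Def 2.4(ii) p.25] -/
theorem exists_mul_ne_of_isOpen (H : Subgroup (Iw p)) (hH : IsOpen (H : Set (Iw p))) :
    ∃ x ∈ H, ∃ y ∈ H, x * y ≠ y * x := by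
  obtain ⟨m, h1, h2⟩ := exists_pow_mem_of_isOpen H hH
  refine ⟨_, h1, _, h2, fun h => ?_⟩
  have ha := congrArg Iw.a h
  simp only [mul_a, IwahoriWitness.w, mul_zero, add_zero, zero_add] at ha
  have h0 : (p : ℤ_[p]) * (p : ℤ_[p]) ^ m * (p : ℤ_[p]) ^ m = 0 := by linear_combination -ha
  exact mul_ne_zero (mul_ne_zero p_ne_zero (pow_ne_zero _ p_ne_zero)) (pow_ne_zero _ p_ne_zero) h0

/-- For `p` odd, a CLOSED subgroup of `P` containing the unit translation `(1, 0)` and the torus element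
`(0, 1)` is everything (`P = ℤ_p · T₀`, `ℕ` dense in `ℤ_p`, `1 + p` topologically generates `U`).
[cite: MochizukiSemiAnbd2006, Def 2.3(iii) p.25] -/
theorem eq_top_of_isClosed_of_mem (hp2 : p ≠ 2) (H : Subgroup (Iw p)) (hH : IsClosed (H : Set (Iw p)))
    (h10 : (⟨1, 0⟩ : Iw p) ∈ H) (c : ℤ_[p]) (hc1 : (⟨c, 1⟩ : Iw p) ∈ H) : H = ⊤ := by
  have hcl : H.topologicalClosure = H := le_antisymm (Subgroup.topologicalClosure_minimal H le_rfl hH)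
    (Subgroup.le_topologicalClosure H)
  -- translations
  have htr : ∀ a : ℤ_[p], (⟨a, 0⟩ : Iw p) ∈ H := fun a => by
    rw [← hcl]; exact transl_mem_topologicalClosure H h10 a
  -- the torus element `(0, 1) = (c, 0)⁻¹ (c, 1)`
  have h01 : (⟨0, 1⟩ : Iw p) ∈ H := by
    have e : (⟨c, 0⟩ : Iw p) * ⟨0, 1⟩ = ⟨c, 1⟩ := by ext <;> simp [IwahoriWitness.w]
    exact (H.mul_mem_cancel_left (htr c)).mp (e ▸ hc1)
  -- the torus: image of the dense subgroup `⟨1 + p⟩` of `U` under `b_0`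
  have htor : ∀ s : ℤ_[p], (⟨0, s⟩ : Iw p) ∈ H := by
    intro s
    set f : IwU p →* Iw p := (bHom (0 : ℤ_[p])).toMonoidHom with hf
    have hfc : Continuous f := (bHom (0 : ℤ_[p])).continuous_toFun
    have hfs : ∀ t : ℤ_[p], f ⟨t⟩ = ⟨0, t⟩ := fun t => by ext <;> simp [hf]
    have hK : ((Subgroup.closure ({⟨1⟩} : Set (IwU p))) : Set (IwU p)).image f ⊆ H := by
      rintro _ ⟨y, hy, rfl⟩
      have hmap : f y ∈ (Subgroup.closure ({⟨1⟩} : Set (IwU p))).map f := ⟨y, hy, rfl⟩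
      rw [MonoidHom.map_closure, Set.image_singleton, hfs] at hmap
      exact (Subgroup.closure_le _).2 (Set.singleton_subset_iff.2 h01) hmap
    have hs : (⟨s⟩ : IwU p) ∈ closure ((Subgroup.closure ({⟨1⟩} : Set (IwU p))) : Set (IwU p)) := by
      rw [← Subgroup.topologicalClosure_coe, IwU.topologicalClosure_closure_one hp2, Subgroup.coe_top]
      exact Set.mem_univ _
    have himg := image_closure_subset_closure_image hfc ⟨_, hs, rfl⟩
    rw [← hcl, ← SetLike.mem_coe, Subgroup.topologicalClosure_coe, ← hfs s]
    exact closure_mono hK himg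
  rw [eq_top_iff]
  intro x _
  have hx : x = ⟨x.a, 0⟩ * ⟨0, x.s⟩ := by ext <;> simp [IwahoriWitness.w]
  rw [hx]
  exact H.mul_mem (htr x.a) (htor x.s)

end Iw

/-! ### 2. The alternating fold `𝒢_θ(p, n) → 𝓛 = loopGraph p` (a locally open morphism) -/

namespace ProfiniteSemiGraph

open FreeProPRankTwo

variable (p : ℕ) [hp : Fact p.Prime] (n : ℕ → ℕ)

/-- The 2-cell at `β_k⁻` in coordinates: `(ε, 1)·(p^{m+1}, 0) = (ε + (1+p)p^{m+1}, 1)` is the conjugate of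
`b_ε(1+p) = (ε, 1)` by `(−(1+p)p^m, 0)` in `P`. [cite: MochizukiSemiAnbd2006, Rmk 2.4.2 p.26] -/
theorem Iw_transl_conj_bHom (ε : ℤ_[p]) (m : ℕ) :
    (⟨ε, 1⟩ : Iw p) * ⟨((p ^ (m + 1) : ℕ) : ℤ_[p]), 0⟩ =
      ⟨-((1 + p) * (p : ℤ_[p]) ^ m), 0⟩ * Iw.bHom ε ⟨1⟩ * ⟨-((1 + p) * (p : ℤ_[p]) ^ m), 0⟩⁻¹ := by
  obtain ⟨hs, ha⟩ := Iw.conj_coords (⟨-((1 + p) * (p : ℤ_[p]) ^ m), 0⟩ : Iw p) (Iw.bHom ε ⟨1⟩)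
  ext
  · rw [ha]
    simp only [Iw.mul_a, Iw.bHom_a, Iw.bHom_s, IwahoriWitness.w]
    push_cast
    ring
  · rw [hs]
    simp only [Iw.mul_s, Iw.bHom_s]
    ring

/-- **The alternating fold `𝒢_θ(p, n) → loopGraph p` is a LOCALLY OPEN morphism of semi-graphs of
anabelioids** (`p` odd, `n_k ≥ 1`): base ray `→ H₁` (vertices to `v_H`, edges to the loop, the branch of `e_k`
at `v_j` to the loop branch of coefficient `parity j` — injective on the two branches of `e_k`); vertex
homomorphisms `f_j : F̂₂⁽ᵖ⁾ → P`, `a ↦ (parity j, 1) = b_{parity j}(1+p)`, `b ↦ (1, 0)`, and edge homomorphisms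
`ℤ_p → U`, `1 ↦ 1+p` (universal properties of the pro-`p` completions; all ONTO); 2-cells with conjugators `1`
at `β_k⁺` (`f_{k+1}(a) = b_{parity(k+1)}(1+p)`) and `(−(1+p)p^{n_k−1}, 0)` at `β_k⁻`
(`f_k(a·b^{p^{n_k}}) = (parity k + (1+p)p^{n_k}, 1)`, `Iw_transl_conj_bHom`).
[cite: MochizukiSemiAnbd2006, Def 2.2(ii) p.24] -/
theorem exists_isLocallyOpen_hom_thetaRayFreeProP_loopGraph (hp2 : p ≠ 2) (hn : ∀ k, 1 ≤ n k) :
    ∃ F : Hom (thetaRayFreeProP p n) (IwahoriWitness.loopGraph p), F.IsLocallyOpen := by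
  -- the vertex and edge homomorphisms
  choose f hfa hfb using fun j : ℕ =>
    Iw.exists_lift (p := p) ⟨(if Nat.bodd j then 1 else 0 : ℤ_[p]), 1⟩ ⟨1, 0⟩
  obtain ⟨g, hg⟩ := IwU.exists_zpow (p := p) ⟨1⟩
  -- the underlying morphism of semi-graphs
  let base : SemiGraph.Hom SemiGraph.ray (SemiGraph.bouquet.{0} 1) :=
    { vertexMap := fun _ => PUnit.unit
      edgeMap := fun _ => ⟨0⟩
      branchMap := fun b => ⟨(0, Nat.bodd (if b.2 then b.1 + 1 else b.1))⟩
      edgeOf_branchMap := fun _ => rfl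
      branchMap_injOn := by
        rintro ⟨k₁, c₁⟩ ⟨k₂, c₂⟩ he hb
        change k₁ = k₂ at he
        subst he
        have h2 := congrArg (fun β : (SemiGraph.bouquet.{0} 1).Branch => β.down.2) hb
        cases c₁ <;> cases c₂ <;> simp [Nat.bodd_succ] at h2 ⊢
      abuts_branchMap := fun _ _ _ => rfl }
  refine ⟨{ base := base, hV := fun j => f j, hE := fun _ => g, comm := ?_ }, ?_, ?_⟩
  · rintro ⟨k, c⟩ v h
    cases c
    · -- `β_k⁻` abuts to `v_k`; gluing `θ_{n_k} ∘ α`; target branch of coefficient `parity k`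
      have hv : v = k := by simpa using (Option.some.inj h).symm
      subst hv
      obtain ⟨m, hm⟩ : ∃ m, n v = m + 1 := ⟨n v - 1, by have := hn v; omega⟩
      refine ⟨⟨-((1 + p) * (p : ℤ_[p]) ^ m), 0⟩, fun x => ?_⟩
      have hfun : (f v).comp (θα p (n v)) =
          (IwahoriWitness.conjHom p ⟨-((1 + p) * (p : ℤ_[p]) ^ m), 0⟩).comp
            ((Iw.bHom (if Nat.bodd v then 1 else 0 : ℤ_[p])).comp g) :=
        padicInt_continuousMonoidHom_ext p (by
          change f v (θα p (n v) (ofAdd 1)) =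
            ⟨-((1 + p) * (p : ℤ_[p]) ^ m), 0⟩ * Iw.bHom (if Nat.bodd v then 1 else 0 : ℤ_[p]) (g (ofAdd 1)) *
              ⟨-((1 + p) * (p : ℤ_[p]) ^ m), 0⟩⁻¹
          rw [θα_eq_zpow, zpow_ofAdd_one, hg, map_mul, map_pow, hfa, hfb, Iw.pow_transl, hm]
          exact Iw_transl_conj_bHom p _ m)
      exact DFunLike.congr_fun hfun x
    · -- `β_k⁺` abuts to `v_{k+1}`; gluing `α`; target branch of coefficient `parity (k+1)`; conjugator `1`
      have hv : v = k + 1 := by simpa using (Option.some.inj h).symm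
      subst hv
      refine ⟨1, fun x => ?_⟩
      have hfun : (f (k + 1)).comp (α p) =
          (IwahoriWitness.conjHom p 1).comp ((Iw.bHom (if Nat.bodd (k + 1) then 1 else 0 : ℤ_[p])).comp g) :=
        padicInt_continuousMonoidHom_ext p (by
          change f (k + 1) (α p (ofAdd 1)) =
            1 * Iw.bHom (if Nat.bodd (k + 1) then 1 else 0 : ℤ_[p]) (g (ofAdd 1)) * 1⁻¹
          rw [α_ofAdd_one, hfa, hg, one_mul, inv_one, mul_one]
          ext <;> simp)
      exact DFunLike.congr_fun hfun x
  · -- vertex homomorphisms onto `P`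
    intro j
    change IsOpen (((f j).toMonoidHom.range : Subgroup (Iw p)) : Set (Iw p))
    rw [Iw.eq_top_of_isClosed_of_mem hp2 (f j).toMonoidHom.range (isCompact_range (f j).continuous).isClosed
      ⟨b p, hfb j⟩ _ ⟨a p, hfa j⟩]
    exact isOpen_univ
  · -- edge homomorphisms onto `U`
    intro e
    change IsOpen ((g.toMonoidHom.range : Subgroup (IwU p)) : Set (IwU p))
    rw [IwU.eq_top_of_isClosed_of_one_mem hp2 g.toMonoidHom.range (isCompact_range g.continuous).isClosed
      ⟨ofAdd 1, hg⟩]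
    exact isOpen_univ

/-! ### 3. No homomorphism into `π₁^temp(loopGraph p)` is quasi-geometric on an abelian maximal compact -/

/-- **A continuous homomorphism into `π₁^temp(𝓛)`, `𝓛` the Iwahori loop, whose source has an ABELIAN maximal
compact subgroup is not quasi-geometric** (Def. 3.8, first clause): by Thm 3.7 (iv) at the finite graph `𝓛`
and Thm 3.7 (i) the maximal compact subgroups of `π₁^temp(𝓛)` are copies of `P = ℤ_p ⋊ (1 + pℤ_p)`, which
has no abelian open subgroup. [cite: MochizukiSemiAnbd2006, Def 3.8 p.42] -/
theorem not_isQuasiGeometric_loopGraph_of_abelian_maximalCompact {G₁ : Type} [Group G₁] [TopologicalSpace G₁]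
    {E : Type} [CommGroup E] (ζ : E →* G₁) (hmax : IsMaximalCompactSubgroup ζ.range)
    (cℋ : TemperedPiChart (IwahoriWitness.loopGraph p)) (φ : G₁ →ₜ* cℋ.G) : ¬ IsQuasiGeometric φ := by
  intro hφ
  obtain ⟨K₂, hK₂, -, hopen⟩ := hφ.maximal _ hmax
  haveI : Finite (IwahoriWitness.loopGraph p).graph.Vertex := (IwahoriWitness.loopGraph_isFinite p).finite_vertex
  haveI : Finite (IwahoriWitness.loopGraph p).graph.Edge := (IwahoriWitness.loopGraph_isFinite p).finite_edge
  obtain ⟨v, ψ, hψ, rfl⟩ :=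
    ((maximalCompactIffVerticialAt_of_finiteGraph (IwahoriWitness.loopGraph_thm37Hypotheses p) cℋ).1 K₂).mp hK₂
  have hinj : Function.Injective ψ :=
    (verticialInjective_holds _ (IwahoriWitness.loopGraph_thm37Hypotheses p) cℋ v).2 ψ hψ
  -- the pull-back `A ⊆ P` of `φ(C)`: an open subgroup of `P`
  let A : Subgroup (Iw p) := (ζ.range.map φ.toMonoidHom).comap ψ.toMonoidHom
  have hA : IsOpen (A : Set (Iw p)) := by
    have hc : Continuous ψ.toMonoidHom.rangeRestrict := continuous_induced_rng.2 ψ.continuous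
    exact hopen.preimage hc
  obtain ⟨x, hx, y, hy, hne⟩ := Iw.exists_mul_ne_of_isOpen A hA
  -- but `A` embeds into the abelian `φ(C)`
  obtain ⟨_, ⟨s, rfl⟩, hs⟩ := Subgroup.mem_map.1 hx
  obtain ⟨_, ⟨t, rfl⟩, ht⟩ := Subgroup.mem_map.1 hy
  have hs' : φ (ζ s) = ψ x := hs
  have ht' : φ (ζ t) = ψ y := ht
  have key : ψ x * ψ y = ψ y * ψ x := by
    rw [← hs', ← ht', ← map_mul, ← map_mul, mul_comm s t, map_mul, map_mul]
  refine hne (hinj ?_)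
  calc ψ (x * y) = ψ x * ψ y := map_mul ψ x y
    _ = ψ y * ψ x := key
    _ = ψ (y * x) := (map_mul ψ y x).symm

/-! ### 4. (R0) is false as typed -/

/-- **`¬ InducedIsQuasiGeometric` — step (R0) of the cell's typed proof of [SemiAnbd] Cor 3.9 (F-1717's
∀-closure) is FALSE as typed.**  Witness: `𝒢 = 𝒢_θ(3, k ↦ k+1)`, `ℋ = loopGraph 3`, canonical charts,
`F =` the alternating fold (locally open), `φ =` the homomorphism induced by `F` (Prop 3.6 (iv); compatible
with `F` on verticial and edge homomorphisms): `φ` is not quasi-geometric, the abelian anchor-free maximal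
compact `C ⊆ π₁^temp(𝒢_θ)` having nowhere to go.  Repaired statements (PROVED, of record):
`inducedIsQuasiGeometricAt_of_finiteGraph`, `inducedIsQuasiGeometricAt_of_compactInVerticialAt`,
`InducedIsQuasiGeometric_of`. [cite: MochizukiSemiAnbd2006, Cor 3.9 p.42] -/
theorem not_inducedIsQuasiGeometric : ¬ InducedIsQuasiGeometric.{0} := by
  intro hR0
  haveI : Fact (Nat.Prime 3) := ⟨Nat.prime_three⟩
  obtain ⟨h36, ζ, h37, hmax, -⟩ :=
    thetaRayFreeProP_exists_maximalCompact_escaping 3 (fun k => k + 1) (fun k => Nat.le_succ k)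
  have h𝒢 : Cor39Hypotheses (thetaRayFreeProP 3 fun k => k + 1) :=
    ⟨h36, h37.isTotallyEstranged, thetaRay_isGraph (G := Grp 3) (E := Multiplicative ℤ_[3]) (up := α 3)
      (low := fun k => θα 3 (k + 1))⟩
  have hℋ : Cor39Hypotheses (IwahoriWitness.loopGraph 3) := IwahoriWitness.loopGraph_cor39Hypotheses 3
  obtain ⟨F, hF⟩ := exists_isLocallyOpen_hom_thetaRayFreeProP_loopGraph 3 (fun k => k + 1) (by decide)
    (fun k => Nat.succ_pos k)
  obtain ⟨φ, -, hV, hE, -⟩ := inducedHomOfMorphism_induces h36 hℋ.toProp36Hypotheses F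
    ((thetaRayFreeProP 3 fun k => k + 1).temperedPiChart h36)
    ((IwahoriWitness.loopGraph 3).temperedPiChart hℋ.toProp36Hypotheses)
  exact not_isQuasiGeometric_loopGraph_of_abelian_maximalCompact 3 ζ.toMonoidHom hmax _ φ
    (hR0 _ _ h𝒢 hℋ _ _ F φ hF hV hE)

end ProfiniteSemiGraph

end Literature.AnabelianGeometry.SemiGraphs

end
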